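/-
Copyright (c) 2026 the pub-hodgecm-mathlib formalisation cell (harness21).  Prover seat hodgecm-mathlib-R90-IF-p04 (g2), programme R90-TF, section S9 «InnerForm-13.3.6 (c)»,
deal (9) (e) «PAY `hgermLevel`» (R90-IF-plan (g2) DEALS #1, R90 bus 2026-09-04T22:54:17Z).
-/
import Summits.HodgeConjecture.HodgeConjecture.Theorems.R90S9InnerFormSec146Levels          -- ★ p862556 (this seat): `Level`, `Evp`, `evpOfClass`, `IsTransportingClass`, `gradePacket` (+ cone: ★ Packets `TransportsToSphAt` ∕ `evpRep`, ★ `tupleOf`)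
import HarnessLib

/-!
# R90-TF · S9 «InnerForm-13.3.6 (c)» — GERM COFINALITY OF THE LEVELS: two discrete packets carrying the germ of ONE discrete class are graded together at every deep
# level — the pin `hgermLevel` of ★ `sec146_of_levels'` ∕ ★ (δ5) `definiteAeRigidity_ofLevelPins` at `Γ₀^{sph} = gammaSph X` (Rogawski 1990 §14.6 p. 242 l. 12–16)

Cell `hodgecm-mathlib`, crux H413 (`stmt-HodgeConjecture-24833`, lane `--supports … --as helper`), route of record `HCCMUnconditional` (no route verbs; count-neutral).
Programme R90-TF, section S9 = InnerForm-13.3.6 (c) (base `R90-IF`); seat R90-IF-p04 (g2).  DEALT BY NAME by R90-IF-plan (g2) 22:54:17Z (9): «PAY `hgermLevel` (the cofinality law —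
your «only S9-internal residue on the (E) road») over the ★ level kit»; census + HEADS posted 23:1xZ (verdict: S9-internal MODULO one named local law, `hframe` below).
THEOREMS ONLY: no `def`, no instance, no notation, no named fact, no `sorry`; namespace `Summit.HodgeConjecture.HodgeConjecture.R90.S9.InnerFormSec146`.
HONEST LABEL: HC_CM is proved only modulo the 7 printed citations (2 remaining named inputs: hLiu418 = stmt-HodgeConjecture-24832, h413 = stmt-HodgeConjecture-24833) until rung 0
closes; helpers ≠ leaves.

## The mathematics [Rogawski1990 §14.6 p. 242 l. 12–16 «`S′` is chosen large enough so that `π_v` is unramified for `v ∉ S′`»; §13.7 p. 206 «ψ_G is injective on e.v.p.'s»]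
`Γ₀.evpRep π′ Π` says: for almost every `v`, the component `π′_v = clFinChoice (repOf π′) v` transports to the unramified member `sph Π_v` along EVERY level-matching frame
`e : U(H′)_v ≃ U(H)_v` (★ `TransportsToSphAt`).  If this holds for `Π` and for `Q`, then off a finite set `π′_v` is admissible, `K_v`-spherical (Flath, ★
`eventually_tupleOf_snd_isSpherical`, `H` anisotropic), unitarizable, and transports to `sph Π_v` AND to `sph Q_v` — it is a transporting class (★ `IsTransportingClass`) for both
packets.  At a place with a level-matching frame `e`, a transporting class is UNIQUE: `comap_e c′ = sph Π_v = comap_e π′_v` forces `c′ = π′_v` (★ `IrrClass.comap_symm_comap`).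
So at every level containing the finite bad set (no transport, ramified, or frameless), the grades `t_{S′}(Π)` and `t_{S′}(Q)` (★ `gradePacket`) are BOTH `some` of the package
of `π′` — equal.  The only input beyond the ★ kit is the COFINITE EXISTENCE OF LEVEL-MATCHING FRAMES for the kit's `H′` (`hframe`; ★ `eventually_exists_cmDatumLocalCongr_levelMatching_three`
at the non-split places for `H′ = qsForm L`; the split places are an S1 ∕ S4 local-structure law).

## What is here (sorry-free, axioms ⊆ {propext, Classical.choice, Quot.sound})
* §1 **`isTransportingClass_unique_of_frame`** — at a place with a level-matching frame two transporting classes for one packet coincide; **`existsUnique_isTransportingClass_of_frame`**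
  — with a witness, `∃!`.
* §2 **`exists_level_gradePacket_eq_of_evpRep`** — COFINAL `hgermLevel`: `Γ₀.evpRep π′ Π → Γ₀.evpRep π′ Q → ∀ l₀, ∃ l ⊇ l₀, ∃ e, gradePacket l Π = some e ∧ gradePacket l Q = some e`
  (`H` anisotropic, `hframe`) — the shape R90-IF-p06's deep-level instantiation consumes (RULING S9-R-Λ).
* §3 **`hgermLevel_gammaSph`** — the (δ5) binder VERBATIM (`∃ l : Level L`), from §2 at `l₀ := ∅`.

[cite: Rogawski1990, §14.6 p. 242 l. 12–16 (chunk p0236 L7–9); §13.7 p. 206 (chunk p0206 L12); §14.2 p. 233; §13.3 p. 201] [cite: FlathCorvallis1979, Thm. 3] [cite: CartierCorvallis1979, §IV.1 Cor. 4.1]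
-/

set_option autoImplicit false
set_option linter.dupNamespace false  -- the mandated namespace repeats the summit's segment (`HodgeConjecture.HodgeConjecture`)

noncomputable section

open NumberField IsDedekindDomain MeasureTheory Filter
open scoped Matrix MatrixGroups Classical
open Literature.NumberTheory Literature.NumberTheory.Automorphic Literature.NumberTheory.Automorphic.UnitaryGroup
open Literature.NumberTheory.Rogawski1990
open Summit.HodgeConjecture.HodgeConjecture.Cruxes.H413 Summit.HodgeConjecture.HodgeConjecture.Cruxes.H413.F0P3ClassTokenChoice
open Summit.HodgeConjecture.HodgeConjecture.Cruxes.H413.F0P3GlobalPacket Summit.HodgeConjecture.HodgeConjecture.Cruxes.H413.F0P3LocalPacketKit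

namespace Summit.HodgeConjecture.HodgeConjecture.R90.S9.InnerFormSec146

section Cofinality

variable (TG' TG TH : Type) (L : Type) [Field L] [NumberField L] [IsCMField L] (ι : L →+* ℂ) (H : Matrix (Fin 3) (Fin 3) L) (T : GL (Fin 3) ℂ)
  (hT : (T : Matrix (Fin 3) (Fin 3) ℂ)ᴴ * H.map ι * (T : Matrix (Fin 3) (Fin 3) ℂ) = Literature.Geometry.ComplexHyperbolic.BallModel.J)
  (μA : Measure (adelicGroupData (↥(maximalRealSubfield L)) L (IsCMField.complexConj L) 3 H).automorphicQuotient)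
  [(adelicGroupData (↥(maximalRealSubfield L)) L (IsCMField.complexConj L) 3 H).IsAutomorphicMeasure μA]
  (μv : ∀ v : HeightOneSpectrum (𝓞 ↥(maximalRealSubfield L)), @Measure ((cmDatum L 3 H).Local v) (borel _))
  (Ξ : OneDimAutRepH L → PacketPrimeFin L H) {H' : Matrix (Fin 3) (Fin 3) L}
  (𝔩 : ∀ v : HeightOneSpectrum (𝓞 ↥(maximalRealSubfield L)), LocalPacketKit L H' v)
  (X : DatumInputs TG' TG TH L ι H T hT μA Ξ 𝔩)

/-! ## §1 At a place with a level-matching frame the transporting class is unique -/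

/-- **UNIQUENESS OF THE TRANSPORTING CLASS AT A PLACE WITH A LEVEL-MATCHING FRAME**: if some frame `e = cmDatumLocalCongr L v T a …` matches the integral levels
(`e⁻¹(K_v^{H′}) = K_v^{H}` read pointwise), then two transporting classes for the same packet `Π` at `v` coincide — both pull back along `e` to `sph Π_v`, and pulling back along a
group isomorphism is injective on classes (★ `IrrClass.comap_symm_comap`). [cite: Rogawski1990, §13.7 p. 206 (chunk p0206 L12) «ψ_G is injective on e.v.p.'s»; §14.2 p. 233] -/
theorem isTransportingClass_unique_of_frame (P : X.G.Packet) (v : HeightOneSpectrum (𝓞 ↥(maximalRealSubfield L)))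
    (hfr : ∃ (T₁ : GL (Fin 3) (LocalRing L v)) (a : LocalRing L v) (ha : IsUnit a)
      (h : formCongr (conjLocal L (IsCMField.complexConj L) v) T₁ (H.map (algebraMap L (LocalRing L v))) = a • H'.map (algebraMap L (LocalRing L v))),
      ∀ g : (cmDatum L 3 H).Local v, (cmDatumLocalCongr L v T₁ ha h).symm g ∈ cmLocalIntegralLevel L 3 H' v ↔ g ∈ cmLocalIntegralLevel L 3 H v)
    {c c' : IrrClass ((cmDatum L 3 H).Local v)}
    (hc : IsTransportingClass TG' TG TH L ι H T hT μA Ξ 𝔩 X P v c) (hc' : IsTransportingClass TG' TG TH L ι H T hT μA Ξ 𝔩 X P v c') : c = c' := by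
  obtain ⟨T₁, a, ha, h, hlev⟩ := hfr
  obtain ⟨-, -, -, hu, htr⟩ := hc
  obtain ⟨-, -, -, hu', htr'⟩ := hc'
  have e1 := htr T₁ a ha h hlev
  have e2 := htr' T₁ a ha h hlev
  -- both pull back to the unramified member of `Π_v`
  have e12 : IrrClass.comap (cmDatumLocalCongr L v T₁ ha h) c = IrrClass.comap (cmDatumLocalCongr L v T₁ ha h) c' := by
    rw [e1, e2]
  rw [← IrrClass.comap_symm_comap (cmDatumLocalCongr L v T₁ ha h) c, ← IrrClass.comap_symm_comap (cmDatumLocalCongr L v T₁ ha h) c', e12]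

/-- **`∃!` at a framed place with a witness** (the `some` branch of ★ `gradePacket` at `v`). [cite: Rogawski1990, §14.6 p. 242 l. 10–15; §13.7 p. 206] -/
theorem existsUnique_isTransportingClass_of_frame (P : X.G.Packet) (v : HeightOneSpectrum (𝓞 ↥(maximalRealSubfield L)))
    (hfr : ∃ (T₁ : GL (Fin 3) (LocalRing L v)) (a : LocalRing L v) (ha : IsUnit a)
      (h : formCongr (conjLocal L (IsCMField.complexConj L) v) T₁ (H.map (algebraMap L (LocalRing L v))) = a • H'.map (algebraMap L (LocalRing L v))),
      ∀ g : (cmDatum L 3 H).Local v, (cmDatumLocalCongr L v T₁ ha h).symm g ∈ cmLocalIntegralLevel L 3 H' v ↔ g ∈ cmLocalIntegralLevel L 3 H v)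
    {c : IrrClass ((cmDatum L 3 H).Local v)} (hc : IsTransportingClass TG' TG TH L ι H T hT μA Ξ 𝔩 X P v c) :
    ∃! c' : IrrClass ((cmDatum L 3 H).Local v), IsTransportingClass TG' TG TH L ι H T hT μA Ξ 𝔩 X P v c' :=
  ⟨c, hc, fun _ hc' => (isTransportingClass_unique_of_frame TG' TG TH L ι H T hT μA Ξ 𝔩 X P v hfr hc hc').symm⟩

/-! ## §2–§3 Two germs of one class are graded together at every deep level -/

/-- **GERM COFINALITY (`hgermLevel`, COFINAL FORM)** at `Γ₀^{sph} = gammaSph X`: if the discrete packets `Π` and `Q` both carry the germ of the `K_c`-spherical discrete class `π′`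
(`Γ₀.evpRep π′ Π`, `Γ₀.evpRep π′ Q` — «`t(π′) = t(Π)`», «`t(π′) = t(Q)`»), then for every finite `l₀` there is a level `l ⊇ l₀` at which BOTH are graded, with the SAME grade
(`gradePacket l Π = some e = gradePacket l Q`).  HYPOTHESES: `H` anisotropic (Flath: almost every component of `π′` is `K_v`-spherical, ★ `eventually_tupleOf_snd_isSpherical`)
and the COFINITE EXISTENCE OF LEVEL-MATCHING FRAMES `U(H′)_v ≃ U(H)_v` for the kit's form `H′` (`hframe` — ★ `eventually_exists_cmDatumLocalCongr_levelMatching_three` at the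
non-split places when `H′ = qsForm L`; in general an S1 ∕ S4 local-structure law).  PROOF: off the finite bad set (no transport to `Π`, no transport to `Q`, ramified, frameless)
the component `π′_v` is a transporting class for both packets and (§1) the unique one, so both grades are `some` of `v ↦ t_v(π′_v)`.
[cite: Rogawski1990, §14.6 p. 242 l. 12–16 (chunk p0236 L7–9); §13.7 p. 206; §14.2 p. 233] [cite: FlathCorvallis1979, Thm. 3] -/
theorem exists_level_gradePacket_eq_of_evpRep
    (hanis : ∀ y : Fin 3 → L, Literature.AlgebraicGeometry.ShimuraVarieties.hermForm (cmConjRingHom L) H y y = 0 → y = 0)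
    (hframe : ∀ᶠ v : HeightOneSpectrum (𝓞 ↥(maximalRealSubfield L)) in cofinite,
      ∃ (T₁ : GL (Fin 3) (LocalRing L v)) (a : LocalRing L v) (ha : IsUnit a)
        (h : formCongr (conjLocal L (IsCMField.complexConj L) v) T₁ (H.map (algebraMap L (LocalRing L v))) = a • H'.map (algebraMap L (LocalRing L v))),
        ∀ g : (cmDatum L 3 H).Local v, (cmDatumLocalCongr L v T₁ ha h).symm g ∈ cmLocalIntegralLevel L 3 H' v ↔ g ∈ cmLocalIntegralLevel L 3 H v)
    (π' : RepPrimeSph L ι H T hT μA) (P Q : X.G.Packet)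
    (hP : (gammaSph TG' TG TH L ι H T hT μA Ξ 𝔩 X).evpRep π' P) (hQ : (gammaSph TG' TG TH L ι H T hT μA Ξ 𝔩 X).evpRep π' Q) (l₀ : Level L) :
    ∃ l : Level L, l₀ ⊆ l ∧ ∃ e : Evp L H,
      gradePacket TG' TG TH L ι H T hT μA μv Ξ 𝔩 X l P = some e ∧ gradePacket TG' TG TH L ι H T hT μA μv Ξ 𝔩 X l Q = some e := by
  -- the two germs, read on the representative of record
  have hP' : evpRepOf L H μA 𝔩 (repOf L H μA π'.1) (X.finOfG P) := by
    rw [← evpRep_classOf L H μA 𝔩 (repOf L H μA π'.1) (X.finOfG P), classOf_repOf]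
    exact (gammaSph_evpRep TG' TG TH L ι H T hT μA Ξ 𝔩 X π' P).1 hP
  have hQ' : evpRepOf L H μA 𝔩 (repOf L H μA π'.1) (X.finOfG Q) := by
    rw [← evpRep_classOf L H μA 𝔩 (repOf L H μA π'.1) (X.finOfG Q), classOf_repOf]
    exact (gammaSph_evpRep TG' TG TH L ι H T hT μA Ξ 𝔩 X π' Q).1 hQ
  have hsph := eventually_tupleOf_snd_isSpherical L ι H T hT μA hanis π'
  -- off a finite bad set everything holds at once
  have hall := Filter.eventually_cofinite.1 ((hP'.and hQ').and (hsph.and hframe))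
  refine ⟨l₀ ∪ hall.toFinset, Finset.subset_union_left, ?_⟩
  have hgood : ∀ v, v ∉ l₀ ∪ hall.toFinset →
      (TransportsToSphAt L H 𝔩 v (clFinChoice (repOf L H μA π'.1) v) ((X.finOfG P).loc v) ∧
        TransportsToSphAt L H 𝔩 v (clFinChoice (repOf L H μA π'.1) v) ((X.finOfG Q).loc v)) ∧
      (((tupleOf L ι H T hT μA π').2 v).IsSpherical (cmLocalIntegralLevel L 3 H v) ∧
        ∃ (T₁ : GL (Fin 3) (LocalRing L v)) (a : LocalRing L v) (ha : IsUnit a)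
          (h : formCongr (conjLocal L (IsCMField.complexConj L) v) T₁ (H.map (algebraMap L (LocalRing L v))) = a • H'.map (algebraMap L (LocalRing L v))),
          ∀ g : (cmDatum L 3 H).Local v, (cmDatumLocalCongr L v T₁ ha h).symm g ∈ cmLocalIntegralLevel L 3 H' v ↔ g ∈ cmLocalIntegralLevel L 3 H v) := by
    intro v hv
    by_contra hbad
    exact hv (Finset.mem_union_right _ (hall.mem_toFinset.2 hbad))
  -- off the bad set the component of `π′` is THE transporting class, for `Π` and for `Q`
  have hcP : ∀ v, v ∉ l₀ ∪ hall.toFinset → IsTransportingClass TG' TG TH L ι H T hT μA Ξ 𝔩 X P v ((tupleOf L ι H T hT μA π').2 v) := fun v hv =>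
    ⟨by rw [tupleOf_snd]; exact clFinChoice_isAdmissible (repOf L H μA π'.1) v, (hgood v hv).2.1, tupleOf_snd_isUnitarizable L ι H T hT μA π' v, (hgood v hv).1.1⟩
  have hcQ : ∀ v, v ∉ l₀ ∪ hall.toFinset → IsTransportingClass TG' TG TH L ι H T hT μA Ξ 𝔩 X Q v ((tupleOf L ι H T hT μA π').2 v) := fun v hv =>
    ⟨by rw [tupleOf_snd]; exact clFinChoice_isAdmissible (repOf L H μA π'.1) v, (hgood v hv).2.1, tupleOf_snd_isUnitarizable L ι H T hT μA π' v, (hgood v hv).1.2⟩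
  have huP : ∀ v, v ∉ l₀ ∪ hall.toFinset → ∃! c : IrrClass ((cmDatum L 3 H).Local v), IsTransportingClass TG' TG TH L ι H T hT μA Ξ 𝔩 X P v c := fun v hv =>
    existsUnique_isTransportingClass_of_frame TG' TG TH L ι H T hT μA Ξ 𝔩 X P v (hgood v hv).2.2 (hcP v hv)
  have huQ : ∀ v, v ∉ l₀ ∪ hall.toFinset → ∃! c : IrrClass ((cmDatum L 3 H).Local v), IsTransportingClass TG' TG TH L ι H T hT μA Ξ 𝔩 X Q v c := fun v hv =>
    existsUnique_isTransportingClass_of_frame TG' TG TH L ι H T hT μA Ξ 𝔩 X Q v (hgood v hv).2.2 (hcQ v hv)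
  refine ⟨_, gradePacket_of_forall TG' TG TH L ι H T hT μA μv Ξ 𝔩 X _ P huP, ?_⟩
  rw [gradePacket_of_forall TG' TG TH L ι H T hT μA μv Ξ 𝔩 X _ Q huQ]
  congr 1
  funext v
  by_cases hv : v ∈ l₀ ∪ hall.toFinset
  · rw [dif_pos hv, dif_pos hv]
  · rw [dif_neg hv, dif_neg hv, (huQ v hv).unique (Classical.choose_spec (huQ v hv).exists) (hcQ v hv),
      (huP v hv).unique (Classical.choose_spec (huP v hv).exists) (hcP v hv)]

/-- **THE `hgermLevel` BINDER OF ★ (δ5) `definiteAeRigidity_ofLevelPins` ∕ ★ `sec146_of_levels'` AT `Γ₀^{sph}`, VERBATIM** (`tP := gradePacket X`, `Λ := Level L`): two packets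
carrying the germ of one discrete class are graded together at SOME level — §2 at `l₀ := ∅`.  (`H` anisotropic; `hframe` = cofinite level-matching frames for the kit's `H′`.)
[cite: Rogawski1990, §14.6 p. 242 l. 12–16 (chunk p0236 L7–9); §13.7 p. 206] [cite: FlathCorvallis1979, Thm. 3] -/
theorem hgermLevel_gammaSph
    (hanis : ∀ y : Fin 3 → L, Literature.AlgebraicGeometry.ShimuraVarieties.hermForm (cmConjRingHom L) H y y = 0 → y = 0)
    (hframe : ∀ᶠ v : HeightOneSpectrum (𝓞 ↥(maximalRealSubfield L)) in cofinite,
      ∃ (T₁ : GL (Fin 3) (LocalRing L v)) (a : LocalRing L v) (ha : IsUnit a)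
        (h : formCongr (conjLocal L (IsCMField.complexConj L) v) T₁ (H.map (algebraMap L (LocalRing L v))) = a • H'.map (algebraMap L (LocalRing L v))),
        ∀ g : (cmDatum L 3 H).Local v, (cmDatumLocalCongr L v T₁ ha h).symm g ∈ cmLocalIntegralLevel L 3 H' v ↔ g ∈ cmLocalIntegralLevel L 3 H v) :
    ∀ (π' : (gammaSph TG' TG TH L ι H T hT μA Ξ 𝔩 X).Rep') (P Q : (gammaSph TG' TG TH L ι H T hT μA Ξ 𝔩 X).G.Packet),
      (gammaSph TG' TG TH L ι H T hT μA Ξ 𝔩 X).evpRep π' P → (gammaSph TG' TG TH L ι H T hT μA Ξ 𝔩 X).evpRep π' Q →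
        ∃ (l : Level L) (e : Evp L H),
          gradePacket TG' TG TH L ι H T hT μA μv Ξ 𝔩 X l P = some e ∧ gradePacket TG' TG TH L ι H T hT μA μv Ξ 𝔩 X l Q = some e := by
  intro π' P Q hP hQ
  obtain ⟨l, -, e, hPe, hQe⟩ := exists_level_gradePacket_eq_of_evpRep TG' TG TH L ι H T hT μA μv Ξ 𝔩 X hanis hframe π' P Q hP hQ ∅
  exact ⟨l, e, hPe, hQe⟩

end Cofinality

end Summit.HodgeConjecture.HodgeConjecture.R90.S9.InnerFormSec146

end
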